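import Summits.QuantumFields.BalabanUV.Beta.D1BFx.RoadEndBFxRecutRay
import Summits.QuantumFields.BalabanUV.Beta.D1BFx.ShellRoadEnd

/-!
# Road BF-x, END-TO-END OVER THE RE-CUT REST TABLE AT `gfrz`, WITH THE FAR ROWS IN SHELL-ℓ¹ CURRENCY (the END of record p224363 and its
# RAY twin p224967 re-pointed to leaf-07-g4's `ShellRoadEnd.d1Drift_of_strongRoad_shell`)

HONEST DEPENDENCY (page 1, mandatory): continuum YM on T⁴ ⇐ BetaPertH ∧ nine spine estimates (0/9 proved); BetaPertH ⇐ (D1) ∧ (D4) ∧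
CAP+tail; G-an2-4 gates asym, D1 and NE2/3/4.  HONEST FRAMING (cell contract, verbatim): «discharging `BetaPertH` makes Bałaban's UV
stability UNCONDITIONAL — a real constructive-QFT result; it is NOT the continuum limit and NOT the Clay problem.»  THIS MODULE DISCHARGES
NOTHING of the wall: it is [folklore] re-wiring of tree ENDs BY NAME.  No `def`, no `Prop` mirror, no cited fact, 0 sorry; 0 wall binders
instantiated (hW∕hR∕D1Tel∕D1Rep = 0∕4); NOT D1, NOT `BetaPertH`, NOT continuum, NOT Clay.

ABSOLUTE RULE (cell charter, verbatim): «No internally-minted statement may enter as a cited fact. Every hypothesis is either kernel-proved in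
this package or a verbatim quotation of a PUBLISHED theorem with page reference. The manuscript(s) under audit are NOT citable for their own
disputed steps — they are the thing under adjudication; programme-internal (2001/route/tribunal) claims are never citable.»

WHY.  The road's END of record `RoadEndBFxRecut.d1Drift_BFx_recut` (owner d1-p2-g3, p224363) and its RAY twin `RoadEndBFxRecutRay.d1Drift_BFx_recut_ray`
(p224967) display the frozen profile's FAR rows h2∕d2 as SUP rows — `|D_{μν}(gfrz n a b − gFree)(v)| ≤ D₂/n⁴` on all of `ℤ⁴` and
`|D_{μν}(gfrz n a b)(v)| ≤ A₂e^{−(δ/n)‖v‖∞}/‖v‖∞⁴` — where `D_{μν}` is the mixed-direction second difference of `v ↦ K^∞((b,κ),(b+ε•v,κ))`, i.e.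
TWO DIFFERENCES ON THE SAME LEG of the propagator.  Two located facts about these rows:
(a) they are NOT in the printed pointwise list of [Balaban1984PropagatorsI, Prop. 1.2 (1.110)–(1.114), pp. 35–36] (tree: `B5.Prop12Printed`):
    (1.110) prints `|GJ|, |∇GJ|, |G∇*J|, |ΔGJ|` pointwise, (1.112) the MIXED `|∇G∇*J|` pointwise with a Hölder loss, and the same-leg second
    derivatives `∇∇GJ`, `G∇*∇*J` appear ONLY in the `L²` list (1.114);
(b) the cell's own evidence-grade numerics (leaf-07-g3 RESULT, journal l.10890, kit j094529∕j094530; beta-num-g33 ENGINE-2 l.11249∕l.11375) measured,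
    for the block-averaged scalar column, `n⁴·max_v |D_{μν}(flat part)(v)| ≈ c₀ + c₁ log n` (`c₁ ≈ 0.15–0.17`, not saturating) with the maximum ON
    THE CODIMENSION-2 BLOCK EDGES, while the shell sums `Σ_{‖v‖∞ = r+1}|D_{μν}(flat)(v)|` are of the typed size; the located mechanism — the flat part
    is `∂G₀ ∗ (face-jump layers of a Q*-output)`, and at an edge `∫₁ⁿ ρ²·ρ/ρ⁴ dρ = log n` — applies verbatim to the gluon diagonal entries for the
    components `κ ∉ {μ,ν}` (the bond-averaging weight of component `κ` is an indicator in every direction `≠ κ`) and is not removed by the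
    64-pattern∕4-component average defining `gfrz` — HEURISTIC transfer, NOT computed for `K^∞` itself and asserted nowhere.
So the SUP rows h2∕d2 are presumably unsatisfiable by `gfrz` (by a factor `log n`), whereas leaf-07-g4's SHELL END (`ShellRoadEnd`, `ShellGradedRoad`,
`ShellWindowEnd`, `ShellWindowLegs`, `ShellWindowInterface`, `ShellFullSum`, `ShellStencils`) asks of the mixed second differences ONLY their shell sums.
THIS FILE re-points the road's END of record to that END: every hypothesis of `d1Drift_BFx_recut` is displayed BYTE-IDENTICALLY except

* `h2s : ∀ n ≥ 2, ∀ b ∈ image resSite, ∀ r, r + 1 ≤ n → Σ_{‖v‖∞=r+1}|D_{μν}(gfrz n a b − gFree)(v)| ≤ D₂/n`,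
* `d2s : ∀ n ≥ 2, ∀ b ∈ image resSite, ∀ r ≥ n, Σ_{‖v‖∞=r+1}|D_{μν}(gfrz n a b)(v)| ≤ A₂e^{−(δ/n)(r+1)}/(r+1)`,

and §1 proves (generically, for any leg family) that the pointwise rows IMPLY the shell rows with `D₂ ↦ 80·D₂`, `A₂ ↦ 80·A₂` (`#shell ≤ 80(r+1)³`,
leaf-07-g4's `ShellStencils.shell_sum_le_of_pointwise`) — so `d1Drift_BFx_recut_shell` is kernel-visibly MORE GENERAL than the END of record, nothing is
lost, and the road's far-row debt is now displayed in a currency the cell's evidence says is payable ((α)-leaf content: the analytic shell rows for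
`K^∞`'s diagonal are NOT proved here or anywhere in the tree).

CONTENT.
* §1 [folklore] `h2s_of_h2`, `d2s_of_d2` — pointwise far rows ⟹ shell rows (any base-point-indexed family `Gf : ℕ → κB → Pt → ℝ`).
* §2 [folklore] **`d1Drift_BFx_recut_shell`** — `RoadEndBFxRecut.d1Drift_BFx_recut` with h2∕d2 ↦ h2s∕d2s, composed through
  `ShellRoadEnd.d1Drift_of_strongRoad_shell` (the rest of the wiring — `rest_all_of_offCorner`, `AssemblyEnd.hT_of_pointwise`,
  `AssemblyEndRecut.defect_le_at_recut`, the UNCONDITIONAL near rows `abs_gfrz_sub_gFree_le`∕`abs_gfrz_diff_flat_le`, `decay_gfrz`, `gfrz_neg` — verbatim).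
* §3 [folklore] **`d1Drift_BFx_recut_ray_shell`** — the same for the RAY twin (ghost weights `(x₀, cK, cQ) := (−cgh n, cgh n·n², cgh n·a)`; `hrowgh` is the
  theorem `GhostKernelComplete.hasSum_row_fineHessGhQ_ray`).
(With §1 at `Bset n := image resSite`, the END of record's own far-row hypotheses feed §2 with `D₂ ↦ 80·D₂`, `A 2 ↦ 80·A 2`: the re-typing is a
weakening of hypotheses, nothing else changes.)
Unit `b2b-balaban-beta-d1-formalise-leaf-03` (gen 5), D1 formalisation swarm; `LEAVES-BFx.md` sub-row «C3-SHELL@recut»; journal INTENT 2026-08-20T16:13Z.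
-/

noncomputable section

open Finset Filter Topology
open scoped BigOperators
open Literature.Probability.LatticeModels (annulus)
open Literature.MathematicalPhysics.QuantumFieldTheory.Balaban1983to89
open Literature.MathematicalPhysics.QuantumFieldTheory.Balaban1983to89.Beta
open OneStepResolventKernel (JetData)
open OneStepKernelFamily (TbalOf D1Drift)
open WindowIdentification (fullSum psum)
open DyadicShell (Pt toReal supNorm supNorm_eq_of_mem_sphere ne_zero_of_mem_annulus)
open ExpKernelCalculus (Site MKer BiLoc shiftK)
open SquareTable (stK)
open GhostTable (gFree)
open BubbleTransfer (unitVec)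
open DressedMomentNormalisation (resSite)
open Summit.QuantumFields.BalabanUV.Beta.TameKernelCalculus (Spr)
open Summit.QuantumFields.BalabanUV.Beta.D1BFx.GluonLeg (Ga)
open Summit.QuantumFields.BalabanUV.Beta.D1BFx.ReducedKernel (TableR TOfRed)
open Summit.QuantumFields.BalabanUV.Beta.D1BFx.DressedTadpoleTable (tableRed)
open Summit.QuantumFields.BalabanUV.Beta.D1BFx.ReducedKernelSandwich (fineHess)
open Summit.QuantumFields.BalabanUV.Beta.D1BFx.FineStencilBFBalaban (SbfBal)
open Summit.QuantumFields.BalabanUV.Beta.D1BFx.SecondStencilBF (Wbf)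
open Summit.QuantumFields.BalabanUV.Beta.D1BFx.GhostKernelComplete (PghQ fineHessGhQ hasSum_row_fineHessGhQ_ray)
open Summit.QuantumFields.BalabanUV.Beta.D1BFx.FrozenLegProfile (gfrz gfrz_neg decay_gfrz abs_gfrz_sub_gFree_le abs_gfrz_diff_flat_le)
open Summit.QuantumFields.BalabanUV.Beta.D1BFx.SplitInstance (RestIdx)
open Summit.QuantumFields.BalabanUV.Beta.D1BFx.SplitRecut (restK')
open Summit.QuantumFields.BalabanUV.Beta.D1BFx.Assembly (sum_uniform_resSite)
open Summit.QuantumFields.BalabanUV.Beta.D1BFx.AssemblyEnd (hT_of_pointwise)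
open Summit.QuantumFields.BalabanUV.Beta.D1BFx.AssemblyEndRecut (defect_le_at_recut)
open Summit.QuantumFields.BalabanUV.Beta.D1BFx.RoadEndBFxRecut (cornerIdx rowConst gfrz₀ gfrz₀_eq rowConst_nonneg rest_all_of_offCorner)
open Summit.QuantumFields.BalabanUV.Beta.D1BFx.ShellStencils (shell_sum_le_of_pointwise)
open Summit.QuantumFields.BalabanUV.Beta.D1BFx.ShellRoadEnd (d1Drift_of_strongRoad_shell)

namespace Summit.QuantumFields.BalabanUV.Beta.D1BFx.RoadEndBFxRecutShell

/-! ## §1 Pointwise far rows imply shell rows (any base-point-indexed leg family) -/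

section Rows

variable {κB : Type*} {Bset : ℕ → Finset κB} {Gf : ℕ → κB → Pt → ℝ} {μ ν : Fin 4} {D₂ A₂ δ : ℝ}

/-- [folklore] **THE SUP ROW h2 IMPLIES THE SHELL ROW h2s** with `D₂ ↦ 80·D₂`: `#{‖v‖∞ = r+1} ≤ 80(r+1)³` and `(r+1)³/n⁴ ≤ 1/n` for `r + 1 ≤ n`. -/
theorem h2s_of_h2 (hD₂ : 0 ≤ D₂)
    (h2 : ∀ n : ℕ, 2 ≤ n → ∀ b ∈ Bset n, ∀ v,
      |(Gf n b (v + unitVec ν + unitVec μ) - gFree (v + unitVec ν + unitVec μ)) - (Gf n b (v + unitVec ν) - gFree (v + unitVec ν)) -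
          (Gf n b (v + unitVec μ) - gFree (v + unitVec μ)) + (Gf n b v - gFree v)| ≤ D₂ / (n : ℝ) ^ 4) :
    ∀ n : ℕ, 2 ≤ n → ∀ b ∈ Bset n, ∀ r : ℕ, r + 1 ≤ n →
      ∑ v ∈ annulus 4 r (r + 1), |(Gf n b (v + unitVec ν + unitVec μ) - gFree (v + unitVec ν + unitVec μ)) -
          (Gf n b (v + unitVec ν) - gFree (v + unitVec ν)) - (Gf n b (v + unitVec μ) - gFree (v + unitVec μ)) +
          (Gf n b v - gFree v)| ≤ 80 * D₂ / (n : ℝ) := by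
  intro n hn b hb r hr
  have hnpos : (0 : ℝ) < n := by exact_mod_cast (show 0 < n by omega)
  have hB : 0 ≤ D₂ / (n : ℝ) ^ 4 := by positivity
  refine (shell_sum_le_of_pointwise
    (f := fun v => (Gf n b (v + unitVec ν + unitVec μ) - gFree (v + unitVec ν + unitVec μ)) -
      (Gf n b (v + unitVec ν) - gFree (v + unitVec ν)) - (Gf n b (v + unitVec μ) - gFree (v + unitVec μ)) + (Gf n b v - gFree v))
    hB (fun v _ => h2 n hn b hb v)).trans ?_
  have hr' : (r : ℝ) + 1 ≤ n := by exact_mod_cast hr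
  have h3 : ((r : ℝ) + 1) ^ 3 ≤ (n : ℝ) ^ 3 := pow_le_pow_left₀ (by positivity) hr' 3
  calc 80 * ((r : ℝ) + 1) ^ 3 * (D₂ / (n : ℝ) ^ 4) = 80 * D₂ * ((r : ℝ) + 1) ^ 3 / (n : ℝ) ^ 4 := by ring
    _ ≤ 80 * D₂ * (n : ℝ) ^ 3 / (n : ℝ) ^ 4 := by gcongr
    _ = 80 * D₂ / (n : ℝ) := by field_simp

/-- [folklore] **THE SUP ROW d2 IMPLIES THE SHELL ROW d2s** with `A₂ ↦ 80·A₂`: on the shell `‖v‖∞ = r + 1` the envelope is the constant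
`A₂e^{−(δ/n)(r+1)}/(r+1)⁴` and `#shell ≤ 80(r+1)³`. -/
theorem d2s_of_d2 (hA₂ : 0 ≤ A₂)
    (d2 : ∀ n : ℕ, 2 ≤ n → ∀ b ∈ Bset n, ∀ v : Pt, v ≠ 0 →
      |Gf n b (v + unitVec ν + unitVec μ) - Gf n b (v + unitVec ν) - Gf n b (v + unitVec μ) + Gf n b v| ≤
        A₂ * Real.exp (-(δ / n) * supNorm v) / (supNorm v : ℝ) ^ 4) :
    ∀ n : ℕ, 2 ≤ n → ∀ b ∈ Bset n, ∀ r : ℕ, n ≤ r →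
      ∑ v ∈ annulus 4 r (r + 1), |Gf n b (v + unitVec ν + unitVec μ) - Gf n b (v + unitVec ν) - Gf n b (v + unitVec μ) + Gf n b v| ≤
        80 * A₂ * Real.exp (-(δ / n) * ((r : ℝ) + 1)) / ((r : ℝ) + 1) := by
  intro n hn b hb r _
  have hr1 : (0 : ℝ) < (r : ℝ) + 1 := by positivity
  have hB : 0 ≤ A₂ * Real.exp (-(δ / n) * ((r : ℝ) + 1)) / ((r : ℝ) + 1) ^ 4 := by positivity
  have hpt : ∀ v ∈ annulus 4 r (r + 1),
      |Gf n b (v + unitVec ν + unitVec μ) - Gf n b (v + unitVec ν) - Gf n b (v + unitVec μ) + Gf n b v| ≤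
        A₂ * Real.exp (-(δ / n) * ((r : ℝ) + 1)) / ((r : ℝ) + 1) ^ 4 := by
    intro v hv
    have h := d2 n hn b hb v (ne_zero_of_mem_annulus hv)
    have hs : ((supNorm v : ℕ) : ℝ) = (r : ℝ) + 1 := by rw [supNorm_eq_of_mem_sphere hv]; push_cast; ring
    rwa [hs] at h
  refine (shell_sum_le_of_pointwise
    (f := fun v => Gf n b (v + unitVec ν + unitVec μ) - Gf n b (v + unitVec ν) - Gf n b (v + unitVec μ) + Gf n b v) hB hpt).trans ?_
  rw [show ((r : ℝ) + 1) ^ 4 = ((r : ℝ) + 1) ^ 3 * ((r : ℝ) + 1) by ring]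
  rw [show 80 * ((r : ℝ) + 1) ^ 3 * (A₂ * Real.exp (-(δ / n) * ((r : ℝ) + 1)) / (((r : ℝ) + 1) ^ 3 * ((r : ℝ) + 1)))
      = 80 * A₂ * Real.exp (-(δ / n) * ((r : ℝ) + 1)) / ((r : ℝ) + 1) by
    field_simp]

end Rows

/-! ## §2 The road END over the re-cut table at the frozen profile of record, far rows in shell currency -/

variable {Lc : ℕ} [NeZero Lc] {a N : ℝ} {μ ν : Fin 4} {υ : Type*} [Fintype υ]
  {cE cVH cΛ cR cK cQ cgh cE₂ cJ4 cΛ₂ cR₂ cQ₂ x₀ ωgl ωgh : ℕ → ℝ} {WE WJ WΛ WR WQ : ℕ → TableR} {CE CJ CΛ CRt CQ δW : ℕ → ℝ}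
  {Ru : υ → ℕ → ℝ} {CU : υ → ℝ} {CR : RestIdx → ℝ} {A : ℕ → ℝ} {D₂ δ U₁ : ℝ}

/-- [folklore] **ROAD BF-x, END TO END, OVER THE RE-CUT REST TABLE AT THE FROZEN PROFILE `gfrz`, FAR ROWS IN SHELL-ℓ¹ CURRENCY** (strong grading,
odd blocking factor).  Exactly `RoadEndBFxRecut.d1Drift_BFx_recut` (B1 `hB1`; (K) `hK` + `hω` + `hlam`; the (α)-leaf `Spr (Ga n a)`; the slot-table
sockets; `hdiv`; `hrowgh`; (REST′) off the corner; (U) — VERBATIM) except that the far rows h2∕d2 of `gfrz` are the SHELL rows `h2s`∕`d2s` of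
leaf-07-g4's `ShellRoadEnd.d1Drift_of_strongRoad_shell` (window cut-off `M n = n`); the pointwise rows d0∕d1 stay as they are (they are (1.110) content). -/
theorem d1Drift_BFx_recut_shell (Js : ℕ → JetData 3 Lc) (hμν : μ ≠ ν) (hN : N ≠ 0) (hL : 2 ≤ Lc) (hodd : Odd Lc) (ha : 0 < a) (c : ℕ → ℝ)
    (hD₂ : 0 ≤ D₂) (hA : ∀ j, 0 ≤ A j) (hδ : 0 < δ)
    -- the frozen profile's FAR rows: h2s∕d2s in SHELL currency, d0∕d1 pointwise
    (h2s : ∀ n : ℕ, 2 ≤ n → ∀ [NeZero n], ∀ b ∈ (univ : Finset (Fin 4 → Fin n)).image resSite, ∀ r : ℕ, r + 1 ≤ n →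
      ∑ v ∈ annulus 4 r (r + 1), |(gfrz n a b (v + unitVec ν + unitVec μ) - gFree (v + unitVec ν + unitVec μ)) -
          (gfrz n a b (v + unitVec ν) - gFree (v + unitVec ν)) - (gfrz n a b (v + unitVec μ) - gFree (v + unitVec μ)) +
          (gfrz n a b v - gFree v)| ≤ D₂ / (n : ℝ))
    (d0 : ∀ n : ℕ, 2 ≤ n → ∀ [NeZero n], ∀ b ∈ (univ : Finset (Fin 4 → Fin n)).image resSite, ∀ v : Pt, v ≠ 0 →
      |gfrz n a b v| ≤ A 0 * Real.exp (-(δ / n) * supNorm v) / (supNorm v : ℝ) ^ 2)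
    (d1 : ∀ n : ℕ, 2 ≤ n → ∀ [NeZero n], ∀ b ∈ (univ : Finset (Fin 4 → Fin n)).image resSite, ∀ v : Pt, v ≠ 0 → ∀ ρ : Fin 4,
      |gfrz n a b (v + unitVec ρ) - gfrz n a b v| ≤ A 1 * Real.exp (-(δ / n) * supNorm v) / (supNorm v : ℝ) ^ 3)
    (d2s : ∀ n : ℕ, 2 ≤ n → ∀ [NeZero n], ∀ b ∈ (univ : Finset (Fin 4 → Fin n)).image resSite, ∀ r : ℕ, n ≤ r →
      ∑ v ∈ annulus 4 r (r + 1), |gfrz n a b (v + unitVec ν + unitVec μ) - gfrz n a b (v + unitVec ν) - gfrz n a b (v + unitVec μ) + gfrz n a b v| ≤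
        A 2 * Real.exp (-(δ / n) * ((r : ℝ) + 1)) / ((r : ℝ) + 1))
    -- bridge B1
    (hB1 : ∀ m : ℕ, 1 ≤ m → |(∑ j ∈ range m, B12Beta.secondMoment (TbalOf Lc Js j) μ ν) - c (Lc ^ m)| ≤ U₁)
    -- the (α)-leaf and slot (K) with the loop-weight ratio and the PINNED normalisation
    (hGa : ∀ n : ℕ, 2 ≤ n → ∀ [NeZero n], Spr (Ga n a))
    (hK : ∀ n : ℕ, 2 ≤ n → Odd n → ∀ [NeZero n], c n =
      ωgl n * B12Beta.secondMoment (TOfRed n a (SbfBal n a (cE n) (cVH n) (cΛ n) (cR n) (cK n) (cQ n))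
        (tableRed n (Wbf (cE₂ n) (cJ4 n) (cΛ₂ n) (cR₂ n) (cQ₂ n) (WE n) (WJ n) (WΛ n) (WR n) (WQ n)))) μ ν
      + ωgh n * B12Beta.secondMoment (PghQ n a (x₀ n) (cK n) (cQ n)) μ ν + ∑ u, Ru u n)
    (hω : ∀ n : ℕ, 2 ≤ n → ωgh n * cK n ^ 2 = -2 * (ωgl n * cE n ^ 2)) (hlam : ∀ n : ℕ, 2 ≤ n → ωgl n * cE n ^ 2 = 2 * N ^ 2 * (n : ℝ) ^ 8)
    -- slot-table sockets
    (hδW : ∀ n, 0 < δW n)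
    (hE : ∀ n κ u l u', BiLoc (WE n κ u l u') u u' (CE n) (δW n)) (hJ : ∀ n κ u l u', BiLoc (WJ n κ u l u') u u' (CJ n) (δW n))
    (hΛ : ∀ n κ u l u', BiLoc (WΛ n κ u l u') u u' (CΛ n) (δW n)) (hR : ∀ n κ u l u', BiLoc (WR n κ u l u') u u' (CRt n) (δW n))
    (hQ : ∀ n κ u l u', BiLoc (WQ n κ u l u') u u' (CQ n) (δW n))
    (hEc : ∀ (n : ℕ) (κ : Fin 4) (u : Site 4) (l : Fin 4) (u' t : Site 4),
      WE n κ (u + (n : ℤ) • t) l (u' + (n : ℤ) • t) = shiftK (-((n : ℤ) • t)) (WE n κ u l u'))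
    (hJc : ∀ (n : ℕ) (κ : Fin 4) (u : Site 4) (l : Fin 4) (u' t : Site 4),
      WJ n κ (u + (n : ℤ) • t) l (u' + (n : ℤ) • t) = shiftK (-((n : ℤ) • t)) (WJ n κ u l u'))
    (hΛc : ∀ (n : ℕ) (κ : Fin 4) (u : Site 4) (l : Fin 4) (u' t : Site 4),
      WΛ n κ (u + (n : ℤ) • t) l (u' + (n : ℤ) • t) = shiftK (-((n : ℤ) • t)) (WΛ n κ u l u'))
    (hRc : ∀ (n : ℕ) (κ : Fin 4) (u : Site 4) (l : Fin 4) (u' t : Site 4),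
      WR n κ (u + (n : ℤ) • t) l (u' + (n : ℤ) • t) = shiftK (-((n : ℤ) • t)) (WR n κ u l u'))
    (hQc : ∀ (n : ℕ) (κ : Fin 4) (u : Site 4) (l : Fin 4) (u' t : Site 4),
      WQ n κ (u + (n : ℤ) • t) l (u' + (n : ℤ) • t) = shiftK (-((n : ℤ) • t)) (WQ n κ u l u'))
    (hEs : ∀ n κ u l u', WE n κ u l u' = WE n l u' κ u) (hJs : ∀ n κ u l u', WJ n κ u l u' = WJ n l u' κ u)
    (hΛs : ∀ n κ u l u', WΛ n κ u l u' = WΛ n l u' κ u) (hRs : ∀ n κ u l u', WR n κ u l u' = WR n l u' κ u)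
    (hQs : ∀ n κ u l u', WQ n κ u l u' = WQ n l u' κ u)
    -- first-bond divergence-freeness of the gluon fine Hessian kernel; the ghost Ward rows
    (hdiv : ∀ n : ℕ, 2 ≤ n → ∀ [NeZero n], ∀ (l' : Fin 4) (u' u : Site 4), ∑ κ' : Fin 4,
      (fineHess n a (SbfBal n a (cE n) (cVH n) (cΛ n) (cR n) (cK n) (cQ n))
          (Wbf (cE₂ n) (cJ4 n) (cΛ₂ n) (cR₂ n) (cQ₂ n) (WE n) (WJ n) (WΛ n) (WR n) (WQ n)) κ' l' (u - Pi.single κ' 1) u'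
        - fineHess n a (SbfBal n a (cE n) (cVH n) (cΛ n) (cR n) (cK n) (cQ n))
          (Wbf (cE₂ n) (cJ4 n) (cΛ₂ n) (cR₂ n) (cQ₂ n) (WE n) (WJ n) (WΛ n) (WR n) (WQ n)) κ' l' u u') = 0)
    (hrowgh : ∀ n : ℕ, 2 ≤ n → ∀ [NeZero n], ∀ (κ' l' : Fin 4) (b : Site 4), HasSum (fineHessGhQ n a (x₀ n) (cK n) (cQ n) κ' l' b) 0)
    -- (REST′) for the re-cut words other than the corner, n-UNIFORM; (U)
    (hRest : ∀ n : ℕ, 2 ≤ n → ∀ [NeZero n], ∀ τ : RestIdx, τ ≠ cornerIdx →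
      |∑ b ∈ (univ : Finset (Fin 4 → Fin n)).image resSite, ((n : ℝ) ^ 4)⁻¹ *
        fullSum (fun w : Pt => restK' n a (gfrz n a b) (cE n) (cΛ n) (cR n) (cK n) (cQ n) (cE₂ n) (cJ4 n) (cΛ₂ n) (cR₂ n) (cQ₂ n) (x₀ n)
          (WE n) (WJ n) (WΛ n) (WR n) (WQ n) (ωgl n) (ωgh n) ((n : ℝ) ^ 8) N μ ν b τ w)| ≤ CR τ)
    (hU : ∀ n : ℕ, 2 ≤ n → ∀ u, |Ru u n| ≤ CU u) :
    D1Drift Lc Js N μ ν := by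
  refine d1Drift_of_strongRoad_shell Js hμν hN hL c (Bset := fun n => (univ : Finset (Fin 4 → Fin n)).image resSite)
    (wt := fun n _ => ((n : ℝ) ^ 4)⁻¹) (Gf := gfrz₀ a) (U₂ := (∑ u, CU u) + ∑ τ : RestIdx, (if τ = cornerIdx then 0 else CR τ))
    (D := rowConst a D₂) (A := A) (δ := δ)
    (rowConst_nonneg ha hD₂) hA hδ (fun n _ _ _ => by positivity) (fun n hn => sum_uniform_resSite (by omega)) ?_ ?_ ?_ ?_ ?_ ?_ hB1 ?_
  · -- h0, UNCONDITIONAL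
    intro n hn b _ v
    haveI : NeZero n := ⟨by omega⟩
    rw [gfrz₀_eq a n]
    exact abs_gfrz_sub_gFree_le n (le_trans one_le_two hn) ha b v
  · -- h1, UNCONDITIONAL
    intro n hn b _ v ρ
    haveI : NeZero n := ⟨by omega⟩
    rw [gfrz₀_eq a n]
    exact abs_gfrz_diff_flat_le n (le_trans one_le_two hn) ha b v ρ
  · -- h2s, SHELL currency
    intro n hn b hb r hr
    haveI : NeZero n := ⟨by omega⟩
    rw [gfrz₀_eq a n]
    exact h2s n hn b hb r hr
  · intro n hn b hb v hv
    haveI : NeZero n := ⟨by omega⟩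
    rw [gfrz₀_eq a n]
    exact d0 n hn b hb v hv
  · intro n hn b hb v hv ρ
    haveI : NeZero n := ⟨by omega⟩
    rw [gfrz₀_eq a n]
    exact d1 n hn b hb v hv ρ
  · -- d2s, SHELL currency
    intro n hn b hb r hr
    haveI : NeZero n := ⟨by omega⟩
    rw [gfrz₀_eq a n]
    exact d2s n hn b hb r hr
  -- the road's target `hT` along `n = Lc^m` (verbatim from the END of record)
  refine hT_of_pointwise (c := c)
    (F := fun n => ∑ b ∈ (univ : Finset (Fin 4 → Fin n)).image resSite, ((n : ℝ) ^ 4)⁻¹ * fullSum (stK μ ν N (gfrz₀ a n b)))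
    (U := (∑ u, CU u) + ∑ τ : RestIdx, (if τ = cornerIdx then 0 else CR τ)) (fun n hn hon => ?_) hL hodd
  haveI : NeZero n := ⟨by omega⟩
  rw [gfrz₀_eq a n]
  exact defect_le_at_recut n a (cE n) (cVH n) (cΛ n) (cR n) (cK n) (cQ n) (cE₂ n) (cJ4 n) (cΛ₂ n) (cR₂ n) (cQ₂ n) (x₀ n) (ωgl n) (ωgh n)
    ((n : ℝ) ^ 8) N (gp := gfrz n a) hn hon ha hμν (hGa n hn) (hK n hn hon) (hω n hn) (hlam n hn) (hδW n) (hE n) (hJ n) (hΛ n) (hR n)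
    (hQ n) (hEc n) (hJc n) (hΛc n) (hRc n) (hQc n) (hEs n) (hJs n) (hΛs n) (hRs n) (hQs n) (hdiv n hn) (hrowgh n hn)
    (fun b => decay_gfrz (hGa n hn) b) (fun b w => gfrz_neg w)
    (rest_all_of_offCorner n a (cE n) (cΛ n) (cR n) (cK n) (cQ n) (cE₂ n) (cJ4 n) (cΛ₂ n) (cR₂ n) (cQ₂ n) (x₀ n) (ωgl n) (ωgh n) N
      (WE n) (WJ n) (WΛ n) (WR n) (WQ n) hμν (hGa n hn) (hRest n hn)) (hU n hn)

/-! ## §3 The RAY twin: ghost weights on the Ward ray, far rows in shell currency -/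

/-- [folklore] **ROAD BF-x, END TO END, RE-CUT TABLE, GHOST WEIGHTS ON THE WARD RAY `(x₀, cK, cQ) := (−cgh n, cgh n·n², cgh n·a)`, FAR ROWS IN SHELL
CURRENCY**: `d1Drift_BFx_recut_shell` with `hrowgh` DISCHARGED by `GhostKernelComplete.hasSum_row_fineHessGhQ_ray` — the twin of
`RoadEndBFxRecutRay.d1Drift_BFx_recut_ray` (p224967) with h2∕d2 ↦ h2s∕d2s. -/
theorem d1Drift_BFx_recut_ray_shell (Js : ℕ → JetData 3 Lc) (hμν : μ ≠ ν) (hN : N ≠ 0) (hL : 2 ≤ Lc) (hodd : Odd Lc) (ha : 0 < a)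
    (c : ℕ → ℝ) (hD₂ : 0 ≤ D₂) (hA : ∀ j, 0 ≤ A j) (hδ : 0 < δ)
    (h2s : ∀ n : ℕ, 2 ≤ n → ∀ [NeZero n], ∀ b ∈ (univ : Finset (Fin 4 → Fin n)).image resSite, ∀ r : ℕ, r + 1 ≤ n →
      ∑ v ∈ annulus 4 r (r + 1), |(gfrz n a b (v + unitVec ν + unitVec μ) - gFree (v + unitVec ν + unitVec μ)) -
          (gfrz n a b (v + unitVec ν) - gFree (v + unitVec ν)) - (gfrz n a b (v + unitVec μ) - gFree (v + unitVec μ)) +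
          (gfrz n a b v - gFree v)| ≤ D₂ / (n : ℝ))
    (d0 : ∀ n : ℕ, 2 ≤ n → ∀ [NeZero n], ∀ b ∈ (univ : Finset (Fin 4 → Fin n)).image resSite, ∀ v : Pt, v ≠ 0 →
      |gfrz n a b v| ≤ A 0 * Real.exp (-(δ / n) * supNorm v) / (supNorm v : ℝ) ^ 2)
    (d1 : ∀ n : ℕ, 2 ≤ n → ∀ [NeZero n], ∀ b ∈ (univ : Finset (Fin 4 → Fin n)).image resSite, ∀ v : Pt, v ≠ 0 → ∀ ρ : Fin 4,
      |gfrz n a b (v + unitVec ρ) - gfrz n a b v| ≤ A 1 * Real.exp (-(δ / n) * supNorm v) / (supNorm v : ℝ) ^ 3)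
    (d2s : ∀ n : ℕ, 2 ≤ n → ∀ [NeZero n], ∀ b ∈ (univ : Finset (Fin 4 → Fin n)).image resSite, ∀ r : ℕ, n ≤ r →
      ∑ v ∈ annulus 4 r (r + 1), |gfrz n a b (v + unitVec ν + unitVec μ) - gfrz n a b (v + unitVec ν) - gfrz n a b (v + unitVec μ) + gfrz n a b v| ≤
        A 2 * Real.exp (-(δ / n) * ((r : ℝ) + 1)) / ((r : ℝ) + 1))
    (hB1 : ∀ m : ℕ, 1 ≤ m → |(∑ j ∈ range m, B12Beta.secondMoment (TbalOf Lc Js j) μ ν) - c (Lc ^ m)| ≤ U₁)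
    (hGa : ∀ n : ℕ, 2 ≤ n → ∀ [NeZero n], Spr (Ga n a))
    (hK : ∀ n : ℕ, 2 ≤ n → Odd n → ∀ [NeZero n], c n =
      ωgl n * B12Beta.secondMoment (TOfRed n a (SbfBal n a (cE n) (cVH n) (cΛ n) (cR n) (cgh n * (n : ℝ) ^ 2) (cgh n * a))
        (tableRed n (Wbf (cE₂ n) (cJ4 n) (cΛ₂ n) (cR₂ n) (cQ₂ n) (WE n) (WJ n) (WΛ n) (WR n) (WQ n)))) μ ν
      + ωgh n * B12Beta.secondMoment (PghQ n a (-cgh n) (cgh n * (n : ℝ) ^ 2) (cgh n * a)) μ ν + ∑ u, Ru u n)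
    (hω : ∀ n : ℕ, 2 ≤ n → ωgh n * (cgh n * (n : ℝ) ^ 2) ^ 2 = -2 * (ωgl n * cE n ^ 2))
    (hlam : ∀ n : ℕ, 2 ≤ n → ωgl n * cE n ^ 2 = 2 * N ^ 2 * (n : ℝ) ^ 8)
    (hδW : ∀ n, 0 < δW n)
    (hE : ∀ n κ u l u', BiLoc (WE n κ u l u') u u' (CE n) (δW n)) (hJ : ∀ n κ u l u', BiLoc (WJ n κ u l u') u u' (CJ n) (δW n))
    (hΛ : ∀ n κ u l u', BiLoc (WΛ n κ u l u') u u' (CΛ n) (δW n)) (hR : ∀ n κ u l u', BiLoc (WR n κ u l u') u u' (CRt n) (δW n))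
    (hQ : ∀ n κ u l u', BiLoc (WQ n κ u l u') u u' (CQ n) (δW n))
    (hEc : ∀ (n : ℕ) (κ : Fin 4) (u : Site 4) (l : Fin 4) (u' t : Site 4),
      WE n κ (u + (n : ℤ) • t) l (u' + (n : ℤ) • t) = shiftK (-((n : ℤ) • t)) (WE n κ u l u'))
    (hJc : ∀ (n : ℕ) (κ : Fin 4) (u : Site 4) (l : Fin 4) (u' t : Site 4),
      WJ n κ (u + (n : ℤ) • t) l (u' + (n : ℤ) • t) = shiftK (-((n : ℤ) • t)) (WJ n κ u l u'))
    (hΛc : ∀ (n : ℕ) (κ : Fin 4) (u : Site 4) (l : Fin 4) (u' t : Site 4),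
      WΛ n κ (u + (n : ℤ) • t) l (u' + (n : ℤ) • t) = shiftK (-((n : ℤ) • t)) (WΛ n κ u l u'))
    (hRc : ∀ (n : ℕ) (κ : Fin 4) (u : Site 4) (l : Fin 4) (u' t : Site 4),
      WR n κ (u + (n : ℤ) • t) l (u' + (n : ℤ) • t) = shiftK (-((n : ℤ) • t)) (WR n κ u l u'))
    (hQc : ∀ (n : ℕ) (κ : Fin 4) (u : Site 4) (l : Fin 4) (u' t : Site 4),
      WQ n κ (u + (n : ℤ) • t) l (u' + (n : ℤ) • t) = shiftK (-((n : ℤ) • t)) (WQ n κ u l u'))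
    (hEs : ∀ n κ u l u', WE n κ u l u' = WE n l u' κ u) (hJs : ∀ n κ u l u', WJ n κ u l u' = WJ n l u' κ u)
    (hΛs : ∀ n κ u l u', WΛ n κ u l u' = WΛ n l u' κ u) (hRs : ∀ n κ u l u', WR n κ u l u' = WR n l u' κ u)
    (hQs : ∀ n κ u l u', WQ n κ u l u' = WQ n l u' κ u)
    (hdiv : ∀ n : ℕ, 2 ≤ n → ∀ [NeZero n], ∀ (l' : Fin 4) (u' u : Site 4), ∑ κ' : Fin 4,
      (fineHess n a (SbfBal n a (cE n) (cVH n) (cΛ n) (cR n) (cgh n * (n : ℝ) ^ 2) (cgh n * a))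
          (Wbf (cE₂ n) (cJ4 n) (cΛ₂ n) (cR₂ n) (cQ₂ n) (WE n) (WJ n) (WΛ n) (WR n) (WQ n)) κ' l' (u - Pi.single κ' 1) u'
        - fineHess n a (SbfBal n a (cE n) (cVH n) (cΛ n) (cR n) (cgh n * (n : ℝ) ^ 2) (cgh n * a))
          (Wbf (cE₂ n) (cJ4 n) (cΛ₂ n) (cR₂ n) (cQ₂ n) (WE n) (WJ n) (WΛ n) (WR n) (WQ n)) κ' l' u u') = 0)
    (hRest : ∀ n : ℕ, 2 ≤ n → ∀ [NeZero n], ∀ τ : RestIdx, τ ≠ cornerIdx →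
      |∑ b ∈ (univ : Finset (Fin 4 → Fin n)).image resSite, ((n : ℝ) ^ 4)⁻¹ *
        fullSum (fun w : Pt => restK' n a (gfrz n a b) (cE n) (cΛ n) (cR n) (cgh n * (n : ℝ) ^ 2) (cgh n * a) (cE₂ n) (cJ4 n) (cΛ₂ n) (cR₂ n)
          (cQ₂ n) (-cgh n) (WE n) (WJ n) (WΛ n) (WR n) (WQ n) (ωgl n) (ωgh n) ((n : ℝ) ^ 8) N μ ν b τ w)| ≤ CR τ)
    (hU : ∀ n : ℕ, 2 ≤ n → ∀ u, |Ru u n| ≤ CU u) :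
    D1Drift Lc Js N μ ν :=
  d1Drift_BFx_recut_shell (x₀ := fun n => -cgh n) (cK := fun n => cgh n * (n : ℝ) ^ 2) (cQ := fun n => cgh n * a) Js hμν hN hL hodd ha c hD₂ hA
    hδ h2s d0 d1 d2s hB1 hGa hK hω hlam hδW hE hJ hΛ hR hQ hEc hJc hΛc hRc hQc hEs hJs hΛs hRs hQs hdiv
    (fun n _ _ κ' l' b => hasSum_row_fineHessGhQ_ray n a ha (cgh n) κ' l' b) hRest hU

end Summit.QuantumFields.BalabanUV.Beta.D1BFx.RoadEndBFxRecutShell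

end
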